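import Literature.Analysis.FluidPDE.TaoForcedNormalisedPressure

/-!
# KJ-2 kernel: Tao's forced unconditional uniqueness (W14) is FALSE without the energy clause

Cell `ns-blowup`, seat `ns-blowup-refuter` (g10), KILLSHEET §XXIV row KJ-2. LABEL: refuter kernel
certificate; negative-side support lemma (`_false_without_` shape) for the route item
`TaoForcedUniqueness` of `route-NavierStokesRegularity-PalasekTowerBreakdown`
(:= W14, `Literature.Analysis.FluidPDE.tao2011_forced_unconditionalUniqueness_velocity`).
WHAT THIS IS NOT: not Navier–Stokes evidence; W14 itself is NOT refuted (KJ-2: it is print-exact and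
survives) — this file shows that its finite-energy hypothesis on the COMPETITOR (`_hvE : ∃ C : ℝ≥0,
∀ t ∈ [0,T], ∫⁻‖v t‖ₑ² ≤ C`, Tao's (7)) is load-bearing: any proof of W14 must use it.

Witness (the Galilean drift, classical): on `[0,T] × ℝ³` with force `f = 0`, the rest state
`u ≡ 0`, `p ≡ 0` and the uniformly accelerating drift `v(t,x) = t·e₀`, `q(t,x) = -x₀` are both
smooth classical solutions of the Navier–Stokes system (`∂ₜv = e₀ = -∇q`, `(v·∇)v = 0`, `Δv = 0`,
`div v = 0`) with the same datum `0 ∈ H¹` and the same smooth `H¹` force; `u` has finite energy,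
`v` has not, and `v(T) ≠ u(T)`.

References: T. Tao, *Localisation and compactness properties of the Navier–Stokes global
regularity problem*, Anal. PDE 6 (2013), Def. 1.1 and (7), Cor. 11.4 (arXiv Cor. 71)
[cite: Tao2011, Cor. 11.4]; the drift non-uniqueness without decay is folklore (e.g. J. G. Heywood,
Acta Math. 136 (1976), §1).
-/

noncomputable section

namespace Summit.NavierStokesRegularity.ForcedUniquenessHygiene

open MeasureTheory Set Function Filter
open scoped ENNReal NNReal RealInnerProductSpace ContDiff Laplacian
open Literature.Analysis.FluidPDE

/-- Euclidean `ℝ³` (file-local notation, as in the `Literature.Analysis.FluidPDE` files). -/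
local notation "ℝ³" => EuclideanSpace ℝ (Fin 3)

/-! ## §1 W14 with the competitor's finite-energy clause removed -/

/-- `tao2011_forced_unconditionalUniqueness_velocity` (W14) with the finite-energy hypothesis `_hvE`
on the competitor `v` DROPPED (the one on `u` is kept); everything else verbatim. NOT a fact: it is
refuted below (`not_W14WithoutCompetitorEnergy`). -/
def W14WithoutCompetitorEnergy : Prop :=
  ∀ ⦃ν T : ℝ⦄ (_hν : 0 < ν) (_hT : 0 < T) ⦃f : ℝ → ℝ³ → ℝ³⦄
    (_hf : IsSmoothSpaceTimeOn (Icc 0 T) f)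
    (_hfH1 : ∀ j ≤ 1, ∃ C : ℝ≥0, ∀ t ∈ Icc 0 T, ∫⁻ x, ‖iteratedFDeriv ℝ j (f t) x‖ₑ ^ 2 ≤ C)
    ⦃u v : ℝ → ℝ³ → ℝ³⦄ ⦃p q : ℝ → ℝ³ → ℝ⦄
    (_hu : IsClassicalNSSolutionOn (Icc 0 T) ν f u p)
    (_hv : IsClassicalNSSolutionOn (Icc 0 T) ν f v q)
    (_h₀ : ∀ j ≤ 1, ∫⁻ x, ‖iteratedFDeriv ℝ j (u 0) x‖ₑ ^ 2 < ⊤)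
    (_hdatum : v 0 = u 0)
    (_huE : ∃ C : ℝ≥0, ∀ t ∈ Icc 0 T, ∫⁻ x, ‖u t x‖ₑ ^ 2 ≤ C),
    ∀ t ∈ Icc 0 T, v t = u t

/-- W14 is the energy-guarded special case: it follows from the unguarded statement (so the witness
below says nothing against W14). [cite: Tao2011, Cor. 11.4 (arXiv Cor. 71), p. 36] -/
theorem W14WithoutCompetitorEnergy.imp (h : W14WithoutCompetitorEnergy) :
    ∀ ⦃ν T : ℝ⦄ (_hν : 0 < ν) (_hT : 0 < T) ⦃f : ℝ → ℝ³ → ℝ³⦄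
      (_hf : IsSmoothSpaceTimeOn (Icc 0 T) f)
      (_hfH1 : ∀ j ≤ 1, ∃ C : ℝ≥0, ∀ t ∈ Icc 0 T, ∫⁻ x, ‖iteratedFDeriv ℝ j (f t) x‖ₑ ^ 2 ≤ C)
      ⦃u v : ℝ → ℝ³ → ℝ³⦄ ⦃p q : ℝ → ℝ³ → ℝ⦄
      (_hu : IsClassicalNSSolutionOn (Icc 0 T) ν f u p)
      (_hv : IsClassicalNSSolutionOn (Icc 0 T) ν f v q)
      (_h₀ : ∀ j ≤ 1, ∫⁻ x, ‖iteratedFDeriv ℝ j (u 0) x‖ₑ ^ 2 < ⊤)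
      (_hdatum : v 0 = u 0)
      (_huE : ∃ C : ℝ≥0, ∀ t ∈ Icc 0 T, ∫⁻ x, ‖u t x‖ₑ ^ 2 ≤ C)
      (_hvE : ∃ C : ℝ≥0, ∀ t ∈ Icc 0 T, ∫⁻ x, ‖v t x‖ₑ ^ 2 ≤ C),
      ∀ t ∈ Icc 0 T, v t = u t :=
  fun _ _ hν hT _ hf hfH1 _ _ _ _ hu hv h₀ hdatum huE _ => h hν hT hf hfH1 hu hv h₀ hdatum huE

/-! ## §2 The Galilean drift -/

/-- The drift direction `e₀`. [folklore] -/
def e0 : ℝ³ := EuclideanSpace.single 0 1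

/-- `e₀ ≠ 0`. [folklore] -/
theorem e0_ne_zero : e0 ≠ 0 := by
  simp [e0]

/-- The uniformly accelerating drift `v(t,x) = t·e₀`. [folklore] -/
def drift : ℝ → ℝ³ → ℝ³ := fun t _ => t • e0

/-- Unfolding the drift at a fixed time: the constant field `t·e₀`. [folklore] -/
theorem drift_def (t : ℝ) : drift t = fun _ : ℝ³ => t • e0 := rfl

/-- Its pressure `q(t,x) = -x₀` (so that `-∇q = e₀ = ∂ₜv`). [folklore] -/
def driftPressure : ℝ → ℝ³ → ℝ := fun _ x => -(x 0)

/-- `∇(-x₀) = -e₀`. [folklore] -/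
theorem gradient_driftPressure (t : ℝ) (x : ℝ³) : gradient (driftPressure t) x = -e0 := by
  have hf : HasFDerivAt (driftPressure t) (-(EuclideanSpace.proj (0 : Fin 3) : ℝ³ →L[ℝ] ℝ)) x :=
    (EuclideanSpace.proj (0 : Fin 3) : ℝ³ →L[ℝ] ℝ).hasFDerivAt.neg
  ext i
  have hi : (gradient (driftPressure t) x) i =
      ⟪gradient (driftPressure t) x, EuclideanSpace.single i (1 : ℝ)⟫ := by
    rw [EuclideanSpace.inner_single_right]; simp
  rw [hi, inner_gradient_left, hf.fderiv]
  by_cases h : i = 0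
  · subst h; simp [e0]
  · simp [e0, h]

/-- The drift's one-sided time derivative within `[0,T]` is `e₀`. [folklore] -/
theorem timeDerivWithin_drift {T : ℝ} (hT : 0 < T) {t : ℝ} (ht : t ∈ Icc 0 T) (x : ℝ³) :
    timeDerivWithin (Icc 0 T) drift t x = e0 := by
  rw [timeDerivWithin_apply]
  have h : HasDerivWithinAt (fun s : ℝ => s • e0) ((1 : ℝ) • e0) (Icc 0 T) t :=
    (hasDerivWithinAt_id t _).smul_const e0
  simp only [drift]
  rw [h.derivWithin (uniqueDiffOn_Icc hT t ht), one_smul]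

/-- **The drift is a classical solution** of the unforced Navier–Stokes system on `[0,T] × ℝ³` with
pressure `-x₀`, for every viscosity. [folklore] -/
theorem isClassicalNSSolutionOn_drift {T : ℝ} (hT : 0 < T) (ν : ℝ) :
    IsClassicalNSSolutionOn (Icc 0 T) ν 0 drift driftPressure where
  smooth_velocity := by
    have : ContDiff ℝ ∞ (uncurry drift) := by
      change ContDiff ℝ ∞ fun p : ℝ × ℝ³ => p.1 • e0
      exact contDiff_fst.smul contDiff_const
    exact this.contDiffOn
  smooth_pressure := by
    have : ContDiff ℝ ∞ (uncurry driftPressure) := by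
      change ContDiff ℝ ∞ fun p : ℝ × ℝ³ => -(p.2 0)
      exact ((EuclideanSpace.proj (0 : Fin 3) : ℝ³ →L[ℝ] ℝ).contDiff.comp contDiff_snd).neg
    exact this.contDiffOn
  momentum t ht x := by
    rw [timeDerivWithin_drift hT ht, gradient_driftPressure]
    simp [drift_def, convect]
  divFree t _ := by
    simp only [VectorCalculus.IsDivFree, VectorCalculus.divergence, drift_def]
    intro x
    simp

/-- **The rest state is a classical solution** (zero velocity, zero pressure, zero force).
[folklore] -/
theorem isClassicalNSSolutionOn_zero (S : Set ℝ) (ν : ℝ) :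
    IsClassicalNSSolutionOn S ν 0 (0 : ℝ → ℝ³ → ℝ³) (0 : ℝ → ℝ³ → ℝ) where
  smooth_velocity := contDiffOn_const
  smooth_pressure := contDiffOn_const
  momentum t _ x := by
    simp [convect, Pi.zero_def]
  divFree t _ := by
    simp only [VectorCalculus.IsDivFree, VectorCalculus.divergence]
    intro x
    simp [Pi.zero_def]

/-! ## §3 The finite-energy clause on the competitor is load-bearing -/

/-- **W14 without the competitor's finite-energy clause is FALSE** (Galilean drift against the rest
state: same datum `0`, same force `0`, `ν = T = 1`, `v(1) = e₀ ≠ 0 = u(1)`). Any proof of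
`tao2011_forced_unconditionalUniqueness_velocity` must therefore use `_hvE` (Tao's (7) for `v`).
[cite: Tao2011, Cor. 11.4 (arXiv Cor. 71), p. 36] -/
theorem not_W14WithoutCompetitorEnergy : ¬ W14WithoutCompetitorEnergy := by
  intro h
  have hf : IsSmoothSpaceTimeOn (Icc 0 1) (0 : ℝ → ℝ³ → ℝ³) := contDiffOn_const
  have hfH1 : ∀ j ≤ 1, ∃ C : ℝ≥0, ∀ t ∈ Icc (0 : ℝ) 1,
      ∫⁻ x, ‖iteratedFDeriv ℝ j ((0 : ℝ → ℝ³ → ℝ³) t) x‖ₑ ^ 2 ≤ C :=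
    fun j _ => ⟨0, fun t _ => by simp⟩
  have h₀ : ∀ j ≤ 1, ∫⁻ x, ‖iteratedFDeriv ℝ j ((0 : ℝ → ℝ³ → ℝ³) 0) x‖ₑ ^ 2 < ⊤ :=
    fun j _ => by simp
  have hdatum : drift 0 = (0 : ℝ → ℝ³ → ℝ³) 0 := by
    funext x; simp [drift]
  have huE : ∃ C : ℝ≥0, ∀ t ∈ Icc (0 : ℝ) 1, ∫⁻ x, ‖(0 : ℝ → ℝ³ → ℝ³) t x‖ₑ ^ 2 ≤ C :=
    ⟨0, fun t _ => by simp⟩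
  have heq := h one_pos one_pos hf hfH1 (isClassicalNSSolutionOn_zero (Icc 0 1) 1)
    (isClassicalNSSolutionOn_drift one_pos 1) h₀ hdatum huE 1 ⟨zero_le_one, le_rfl⟩
  have h1 : drift 1 (0 : ℝ³) = 0 := by rw [heq]; rfl
  simp [drift, e0_ne_zero] at h1

end Summit.NavierStokesRegularity.ForcedUniquenessHygiene

end
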